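import Literature.AnabelianGeometry.AbsoluteAnabelian.RelativeGCHomSchemaWitnesses
import HarnessLib

/-!
# [pGC] Theorem A (hom form, FACT-LIST F-1794 `pGC.ThmA`): the direct-head instance forms of the
# model-relative typing (proof-only)

S. Mochizuki, *The local pro-`p` anabelian geometry of curves*, Invent. Math. **138** (1999) [pGC],
Theorem A p. 3 (= Theorem 16.5 p. 86 with the Remark following it, profinite version):
"Let `K` be sub-`p`-adic. Let `X_K` be a smooth variety over `K`. Let `Y_K` be a hyperbolic curve over `K`.
Then the natural map `Hom^{dom}_K(X_K, Y_K) → Hom^{open}_{Γ_K}(Π_{X_K}, Π_{Y_K})` is bijective."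
[cite: MochizukiLocAn1999, Thm A p.3]

PROOF-ONLY companion (abc-iut cell, block F, KEY row INST59D, seat abc-iut-f-055; no `def`, no
`structure`, no `instance`, no `Prop` fact) of abc-iut-L4-t13's `RelativeGrothendieckConjecture.lean`,
where Thm A is typed MODEL-RELATIVELY (cell ruling θ, shape (M)) as the predicate
`pGC.ThmA K D := IsSubpadic K → D.primes = Set.univ → D.RelHomGC` on an abstract
`RelativeAnabelianDatum (absoluteGaloisGrp K)` (an axiom-free INTERFACE).  The universal closure of this
schema is REFUTED in the tree (`pGC.not_forall_thmA`, junk datum with no scheme morphisms over `ℚ_2`,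
`RelativeGCHomSchemaWitnesses.lean`), and the joint satisfiability witness
`pGC.exists_datum_thmA_and_thmA_isom` is an `∃`-statement; the L-F kernel census (plan/LF-KERNEL-STATUS.tsv,
2026-08-27) therefore found NO theorem whose conclusion head is `pGC.ThmA`.  This file supplies the
conclusion-head forms that ARE theorems about the typing, each labelled for what it is:

* `pGC.thmA_of_relHomGC` — CONCLUSION-SUPPLIED form: a datum whose relative hom-GC holds satisfies the
  typed Thm A (the typed fact is the implication «sub-`p`-adic ∧ full profinite ⇒ rel-hom-GC»); this is
  the form through which every model witness of the tree (the point datum of abc-iut-w5-d058) verifies it;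
* `pGC.thmA_of_primes_ne_univ` — VACUOUS-ANTECEDENT form: a geometrically pro-`Σ` datum with `Σ ≠` all
  primes satisfies the typed (PROFINITE-version) Thm A vacuously (the pro-`Σ` / pro-`p` versions of print are
  NOT typed — `TODO(general form)` of the statement file — so nothing is claimed about them);
* `pGC.thmA_of_not_isSubpadic` — VACUOUS-ANTECEDENT form: over a base field that is not sub-`p`-adic the
  typed Thm A holds for every datum (print asserts nothing there either);
* `pGC.thmA_iff_relHomGC` — over a sub-`p`-adic field and a full-profinite datum the typed Thm A IS the
  relative hom-GC property of the datum (so at the INTENDED instance — the étale `π₁` of smooth varieties /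
  hyperbolic curves, not constructible in the tree, FOUNDATIONS row 12 of the cell — the row remains exactly
  Mochizuki's theorem, a NAMED FACT consumed by name).

HONEST LABEL: every positive instance here is DEGENERATE or CONDITIONAL (conclusion supplied / antecedent
empty); refuted-as-schema ≠ refuted-in-print; typed ≠ proved; nothing here bears on [IUTchIII] Cor. 3.12,
and nothing asserts abc proved or refuted.
-/

universe u

namespace Literature.AnabelianGeometry.AbsoluteAnabelian

open AbsTopIII

variable {K : Type u} [Field K] [CharZero K]

/-- **[pGC] Thm A (typed, hom form) from its conclusion.**  A relative anabelian datum over `Γ_K` whose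
relative hom-GC property holds satisfies the typed `pGC.ThmA K D` (whatever `K` and `D.primes` are).
CONCLUSION-SUPPLIED direct-head form. [cite: MochizukiLocAn1999, Thm A p.3] -/
theorem pGC.thmA_of_relHomGC (D : RelativeAnabelianDatum (absoluteGaloisGrp K)) (h : D.RelHomGC) :
    Literature.AnabelianGeometry.AbsoluteAnabelian.pGC.ThmA K D :=
  fun _ _ => h

/-- **[pGC] Thm A (typed, hom form), VACUOUS at geometrically pro-`Σ` data with `Σ ≠` all primes.**
The typing is the PROFINITE version (`D.primes = Set.univ` is an antecedent), so a datum recording proper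
pro-`Σ` fundamental groups satisfies it vacuously.  VACUOUS-ANTECEDENT direct-head form; the printed pro-`p`
version is not typed and nothing is claimed about it. [cite: MochizukiLocAn1999, Thm A p.3] -/
theorem pGC.thmA_of_primes_ne_univ (D : RelativeAnabelianDatum (absoluteGaloisGrp K))
    (h : D.primes ≠ Set.univ) :
    Literature.AnabelianGeometry.AbsoluteAnabelian.pGC.ThmA K D :=
  fun _ hS => absurd hS h

/-- **[pGC] Thm A (typed, hom form), VACUOUS over a base field that is not sub-`p`-adic.**
VACUOUS-ANTECEDENT direct-head form (print's hypothesis «`K` sub-`p`-adic» fails).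
[cite: MochizukiLocAn1999, Thm A p.3] -/
theorem pGC.thmA_of_not_isSubpadic (hK : ¬ IsSubpadic K)
    (D : RelativeAnabelianDatum (absoluteGaloisGrp K)) :
    Literature.AnabelianGeometry.AbsoluteAnabelian.pGC.ThmA K D :=
  fun h _ => absurd h hK

/-- **[pGC] Thm A (typed, hom form) at the data print speaks about IS the relative hom-GC property.**
Over a sub-`p`-adic `K` and for a datum recording the FULL profinite fundamental groups, `pGC.ThmA K D`
holds iff `D.RelHomGC` does — so at the intended instance the row is exactly Mochizuki's theorem, a named
input of the cell. [cite: MochizukiLocAn1999, Thm A p.3] -/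
theorem pGC.thmA_iff_relHomGC (hK : IsSubpadic K) (D : RelativeAnabelianDatum (absoluteGaloisGrp K))
    (hS : D.primes = Set.univ) :
    Literature.AnabelianGeometry.AbsoluteAnabelian.pGC.ThmA K D ↔ D.RelHomGC :=
  ⟨fun h => h hK hS, fun h _ _ => h⟩

/-- **[pGC] Thm A (typed, hom form) holds at the sub-`2`-adic field `ℚ_2` for every datum whose relative
hom-GC holds** — the conclusion-supplied form at the base field of the tree's closure refuter
`pGC.not_forall_thmA` (which uses a datum over `ℚ_2` where `RelHomGC` FAILS): the schema is decided there
datum by datum by `RelHomGC` alone (`pGC.thmA_iff_relHomGC` with `pGC.isSubpadic_padicTwo`).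
[cite: MochizukiLocAn1999, Thm A p.3] -/
theorem pGC.thmA_padicTwo_iff (D : RelativeAnabelianDatum (absoluteGaloisGrp ℚ_[2]))
    (hS : D.primes = Set.univ) :
    Literature.AnabelianGeometry.AbsoluteAnabelian.pGC.ThmA ℚ_[2] D ↔ D.RelHomGC :=
  pGC.thmA_iff_relHomGC pGC.isSubpadic_padicTwo D hS

end Literature.AnabelianGeometry.AbsoluteAnabelian
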